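import Summits.AtomisticToContinuum.HydrodynamicLimit.Theorems.BoltzmannGreenKubo.Negative.ForallN
import Summits.AtomisticToContinuum.HydrodynamicLimit.Theorems.BoltzmannGreenKubo.Negative.PiStatics
import Summits.AtomisticToContinuum.HydrodynamicLimit.Theorems.BoltzmannGreenKubo.Negative.EnergyWitness
import Summits.AtomisticToContinuum.HydrodynamicLimit.Theorems.BoltzmannGreenKubo.Negative.AllWindows

/-!
# Statics of the quadratic conserved charge `P₀P₁` against `Σ g_B` under `⊗ⁿγ`

Negative-knowledge infrastructure for the crux `AntiMazurCoboundaries.BoltzmannGreenKubo` (stmt-AtomisticToContinuum-13985),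
from the standing disprover's `Cruxes/BoltzmannGreenKubo/Disproof.lean` §2d (gen 2); consumed by `Negative/QuadraticMazur.lean`.
For the route's orthogonal observable `g_B(w) = w₀w₁/(1+|w|²)` (`Negative/ForallN`: `g_B ⊥ span(1, v, |v|²)`) and the product of
two momentum components `Q = P₀P₁ = (Σᵢvᵢ₀)(Σⱼvⱼ₁)`: `E[F·Q] = n·m_B` with `m_B = E_γ[g_B(w)w₀w₁] > 0` (`integral_FBv_mul_QBv`:
every cross term is odd under a `γ`-preserving coordinate reflection of ONE particle; `mB_pos`: the integrand is `≥ 0` and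
vanishes only on two `γ`-null hyperplanes), and `E[Q²] = n²` EXACTLY (`integral_QBv_sq_eq`: the cross terms of `Q²` are odd under one-particle coordinate reflections,
the diagonal ones factor by independence of particles / of coordinates; integrability by power means + `E[w_k⁴] = 3`).
refuter-cdisprove-stmt-AtomisticToContinuum-13985-g2-0.
-/

noncomputable section

namespace Summit.AtomisticToContinuum.HydrodynamicLimit.Theorems

open MeasureTheory ProbabilityTheory Filter Topology Set
open Literature.Analysis.FluidPDE Literature.MathematicalPhysics.KineticTheory
open Literature.Analysis.UnboundedOperators
open scoped InnerProductSpace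
open BoltzmannGreenKuboForallN BoltzmannGreenKuboOrthMomentum

namespace BoltzmannGreenKuboQuadraticMazur

/-! ### Gaussian coordinate moments (any coordinate) -/

/-- `w ↦ w_k⁴` is `γ`-integrable. [folklore] -/
theorem integrable_coord_pow_four' (k : Fin 3) : Integrable (fun w : V3 => (w k) ^ 4) (stdGaussian V3) := by
  have h := measurePreserving_coord k
  have hint4 : Integrable (fun x : ℝ => x ^ 4) (gaussianReal 0 1) := by
    have h' := (memLp_id_gaussianReal' (μ := 0) (v := 1) 4 (by simp)).integrable_norm_pow (by norm_num)
    refine h'.congr (Eventually.of_forall fun x => ?_)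
    simp only [id, Real.norm_eq_abs]
    rw [show (4 : ℕ) = 2 * 2 from rfl, pow_mul, sq_abs, ← pow_mul]
  exact (h.integrable_comp (continuous_pow 4).aestronglyMeasurable).2 hint4

/-- `E_γ[w_k⁴] = 3`. [folklore] -/
theorem integral_coord_pow_four' (k : Fin 3) : ∫ w, (w k) ^ 4 ∂stdGaussian V3 = 3 := by
  have h := measurePreserving_coord k
  calc ∫ w, (w k) ^ 4 ∂stdGaussian V3
      = ∫ x, x ^ 4 ∂((stdGaussian V3).map fun w : V3 => w k) :=
        (integral_map h.measurable.aemeasurable (continuous_pow 4).aestronglyMeasurable).symm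
    _ = ∫ x, x ^ 4 ∂gaussianReal 0 1 := by rw [h.map_eq]
    _ = 3 := integral_pow_four_gaussianReal

/-- Coordinates are measurable. [folklore] -/
theorem measurable_coord (k : Fin 3) : Measurable fun w : V3 => w k := (measurePreserving_coord k).measurable

/-! ### Statics on `(ℝ³)ⁿ` under `⊗ⁿ γ`: the observable `Σ g_B`, the charge `P₀P₁` -/

variable {n : ℕ}

/-- The velocity-only form of the observable `Σᵢ g_B(vᵢ)`. [folklore] -/
def FBv (v : Fin n → V3) : ℝ := ∑ i, gB (v i)

/-- The `k`-th momentum component `Σᵢ vᵢₖ`. [folklore] -/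
def Pv (k : Fin 3) (v : Fin n → V3) : ℝ := ∑ i, v i k

/-- The quadratic conserved charge `Q = P₀ P₁`. [folklore] -/
def QBv (v : Fin n → V3) : ℝ := Pv 0 v * Pv 1 v

/-- `m_B = E_γ[g_B(w) w₀ w₁]`. [folklore] -/
def mB : ℝ := ∫ w, gB w * (w 0 * w 1) ∂stdGaussian V3

/-- Measurability of `FBv`. [folklore] -/
theorem measurable_FBv : Measurable (FBv : (Fin n → V3) → ℝ) :=
  Finset.measurable_sum _ fun i _ => continuous_gB.measurable.comp (measurable_pi_apply i)

/-- Measurability of `Pv`. [folklore] -/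
theorem measurable_Pv (k : Fin 3) : Measurable (Pv k : (Fin n → V3) → ℝ) :=
  Finset.measurable_sum _ fun i _ => (measurable_coord k).comp (measurable_pi_apply i)

/-- Measurability of `QBv`. [folklore] -/
theorem measurable_QBv : Measurable (QBv : (Fin n → V3) → ℝ) := (measurable_Pv 0).mul (measurable_Pv 1)

/-- `|FBv| ≤ n`. [folklore] -/
theorem abs_FBv_le (v : Fin n → V3) : |FBv v| ≤ n := by
  unfold FBv
  refine (Finset.abs_sum_le_sum_abs _ _).trans ?_
  calc ∑ i, |gB (v i)| ≤ ∑ _i : Fin n, (1 : ℝ) := Finset.sum_le_sum fun i _ => abs_gB_le _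
    _ = n := by simp

/-- Power means: `(Σᵢ aᵢ)⁴ ≤ n³ Σᵢ aᵢ⁴`. [folklore] -/
theorem sum_pow_four_le (a : Fin n → ℝ) : (∑ i, a i) ^ 4 ≤ (n : ℝ) ^ 3 * ∑ i, a i ^ 4 := by
  have h1 : (∑ i, a i) ^ 2 ≤ n * ∑ i, a i ^ 2 := by
    simpa using sq_sum_le_card_mul_sum_sq (s := Finset.univ) (f := a)
  have h2 : (∑ i, a i ^ 2) ^ 2 ≤ n * ∑ i, (a i ^ 2) ^ 2 := by
    simpa using sq_sum_le_card_mul_sum_sq (s := Finset.univ) (f := fun i => a i ^ 2)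
  have h0 : 0 ≤ (∑ i, a i) ^ 2 := sq_nonneg _
  have hn : (0 : ℝ) ≤ n := by positivity
  calc (∑ i, a i) ^ 4 = ((∑ i, a i) ^ 2) ^ 2 := by ring
    _ ≤ (n * ∑ i, a i ^ 2) ^ 2 := pow_le_pow_left₀ h0 h1 2
    _ = n ^ 2 * (∑ i, a i ^ 2) ^ 2 := by ring
    _ ≤ n ^ 2 * (n * ∑ i, (a i ^ 2) ^ 2) := mul_le_mul_of_nonneg_left h2 (by positivity)
    _ = (n : ℝ) ^ 3 * ∑ i, a i ^ 4 := by
        rw [show (n : ℝ) ^ 3 = n ^ 2 * n by ring, mul_assoc]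
        congr 1
        congr 1
        refine Finset.sum_congr rfl fun i _ => by ring

/-- `vᵢₖ⁴` is integrable under `⊗ⁿγ`. [folklore] -/
theorem integrable_pi_coord_pow_four (i : Fin n) (k : Fin 3) :
    Integrable (fun v : Fin n → V3 => (v i k) ^ 4) (Measure.pi fun _ : Fin n => stdGaussian V3) :=
  ((measurePreserving_eval (fun _ : Fin n => stdGaussian V3) i).integrable_comp
    ((measurable_coord k).pow_const 4).aestronglyMeasurable).2 (integrable_coord_pow_four' k)

/-- `Pₖ⁴` is integrable under `⊗ⁿγ` (dominated by `n³ Σᵢ vᵢₖ⁴`). [folklore] -/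
theorem integrable_Pv_pow_four (k : Fin 3) :
    Integrable (fun v : Fin n → V3 => Pv k v ^ 4) (Measure.pi fun _ : Fin n => stdGaussian V3) := by
  have hdom : Integrable (fun v : Fin n → V3 => (n : ℝ) ^ 3 * ∑ i, (v i k) ^ 4)
      (Measure.pi fun _ : Fin n => stdGaussian V3) :=
    (integrable_finsetSum _ fun i _ => integrable_pi_coord_pow_four i k).const_mul _
  refine hdom.mono' ((measurable_Pv k).pow_const 4).aestronglyMeasurable (Eventually.of_forall fun v => ?_)
  rw [Real.norm_eq_abs, abs_of_nonneg (by positivity)]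
  exact sum_pow_four_le fun i => v i k

/-- `Q²` is integrable under `⊗ⁿγ` (dominated by `(P₀⁴ + P₁⁴)/2`). [folklore] -/
theorem integrable_QBv_sq :
    Integrable (fun v : Fin n → V3 => QBv v ^ 2) (Measure.pi fun _ : Fin n => stdGaussian V3) := by
  have hdom : Integrable (fun v : Fin n → V3 => (Pv 0 v ^ 4 + Pv 1 v ^ 4) / 2)
      (Measure.pi fun _ : Fin n => stdGaussian V3) :=
    ((integrable_Pv_pow_four 0).add (integrable_Pv_pow_four 1)).div_const 2
  refine hdom.mono' (measurable_QBv.pow_const 2).aestronglyMeasurable (Eventually.of_forall fun v => ?_)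
  rw [Real.norm_eq_abs, abs_of_nonneg (sq_nonneg _)]
  unfold QBv
  nlinarith [sq_nonneg (Pv 0 v ^ 2 - Pv 1 v ^ 2)]

/-- `Q` is integrable (from `Q²`). [folklore] -/
theorem integrable_QBv : Integrable (QBv : (Fin n → V3) → ℝ) (Measure.pi fun _ : Fin n => stdGaussian V3) := by
  have h2 := integrable_QBv_sq (n := n)
  have hmem : MemLp (QBv : (Fin n → V3) → ℝ) 2 (Measure.pi fun _ : Fin n => stdGaussian V3) :=
    (memLp_two_iff_integrable_sq measurable_QBv.aestronglyMeasurable).2 h2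
  exact hmem.integrable one_le_two

/-- One cross term `g_B(vᵢ)·vⱼ₀·vₖ₁`. [folklore] -/
def term (i j k : Fin n) (v : Fin n → V3) : ℝ := gB (v i) * (v j 0 * v k 1)

/-- Each cross term is integrable (`|g_B| ≤ 1`, `|ab| ≤ (a²+b²)/2`). [folklore] -/
theorem integrable_term (i j k : Fin n) :
    Integrable (term i j k) (Measure.pi fun _ : Fin n => stdGaussian V3) := by
  have hsq : ∀ (l : Fin n) (c : Fin 3), Integrable (fun v : Fin n → V3 => (v l c) ^ 2)
      (Measure.pi fun _ : Fin n => stdGaussian V3) := fun l c =>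
    ((measurePreserving_eval (fun _ : Fin n => stdGaussian V3) l).integrable_comp
      ((measurable_coord c).pow_const 2).aestronglyMeasurable).2 (integrable_coord_sq' c)
  have hdom : Integrable (fun v : Fin n → V3 => ((v j 0) ^ 2 + (v k 1) ^ 2) / 2)
      (Measure.pi fun _ : Fin n => stdGaussian V3) := ((hsq j 0).add (hsq k 1)).div_const 2
  have hmeas : Measurable (term i j k : (Fin n → V3) → ℝ) :=
    (continuous_gB.measurable.comp (measurable_pi_apply i)).mul
      (((measurable_coord 0).comp (measurable_pi_apply j)).mul ((measurable_coord 1).comp (measurable_pi_apply k)))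
  refine hdom.mono' hmeas.aestronglyMeasurable (Eventually.of_forall fun v => ?_)
  rw [Real.norm_eq_abs]
  unfold term
  rw [abs_mul]
  have h1 := abs_gB_le (v i)
  have h2 : |v j 0 * v k 1| ≤ ((v j 0) ^ 2 + (v k 1) ^ 2) / 2 := by
    rw [abs_le]
    constructor <;> nlinarith [sq_nonneg (v j 0 + v k 1), sq_nonneg (v j 0 - v k 1)]
  nlinarith [abs_nonneg (gB (v i)), abs_nonneg (v j 0 * v k 1)]

/-- The coordinate reflection `w_c ↦ −w_c` of `ℝ³` as a `γ`-preserving measurable involution. [folklore] -/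
def reflT (c : Fin 3) : V3 ≃ᵐ V3 := (reflB c).toHomeomorph.toMeasurableEquiv

/-- Coordinates of `reflT`. [folklore] -/
theorem reflT_apply (c : Fin 3) (w : V3) (l : Fin 3) : reflT c w l = if l = c then -w l else w l :=
  reflB_apply c w l

/-- `reflT` preserves `γ`. [folklore] -/
theorem measurePreserving_reflT (c : Fin 3) : MeasurePreserving (reflT c) (stdGaussian V3) (stdGaussian V3) :=
  ⟨(reflB c).continuous.measurable, stdGaussian_map (reflB c)⟩

/-- Cross terms with `j ≠ i` vanish: reflect coordinate `0` of particle `j`. [folklore] -/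
theorem integral_term_of_ne_left {i j k : Fin n} (hji : j ≠ i) :
    ∫ v, term i j k v ∂(Measure.pi fun _ : Fin n => stdGaussian V3) = 0 := by
  have h1 := (measurePreserving_flipWith (stdGaussian V3) (reflT 0) (measurePreserving_reflT 0) j).integral_comp
    (flipWith (reflT 0) j).measurableEmbedding (term i j k)
  have h2 : (fun v : Fin n → V3 => term i j k (flipWith (reflT 0) j v)) = fun v => -term i j k v := by
    funext v
    unfold term
    rw [flipWith_apply, flipWith_apply, flipWith_apply, if_neg hji.symm, if_pos rfl, reflT_apply, if_pos rfl]
    by_cases hkj : k = j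
    · subst hkj
      rw [if_pos rfl, reflT_apply, if_neg (by decide)]
      ring
    · rw [if_neg hkj]
      ring
  rw [h2, integral_neg] at h1
  linarith

/-- Cross terms with `j = i`, `k ≠ i` vanish: reflect coordinate `1` of particle `k`. [folklore] -/
theorem integral_term_of_ne_right {i k : Fin n} (hki : k ≠ i) :
    ∫ v, term i i k v ∂(Measure.pi fun _ : Fin n => stdGaussian V3) = 0 := by
  have h1 := (measurePreserving_flipWith (stdGaussian V3) (reflT 1) (measurePreserving_reflT 1) k).integral_comp
    (flipWith (reflT 1) k).measurableEmbedding (term i i k)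
  have h2 : (fun v : Fin n → V3 => term i i k (flipWith (reflT 1) k v)) = fun v => -term i i k v := by
    funext v
    unfold term
    rw [flipWith_apply, flipWith_apply, if_neg hki.symm, if_pos rfl, reflT_apply, if_pos rfl]
    ring
  rw [h2, integral_neg] at h1
  linarith

/-- The diagonal term is `m_B`. [folklore] -/
theorem integral_term_diag (i : Fin n) :
    ∫ v, term i i i v ∂(Measure.pi fun _ : Fin n => stdGaussian V3) = mB :=
  integral_diag (stdGaussian V3) (fun w => gB w * (w 0 * w 1))
    (continuous_gB.measurable.mul ((measurable_coord 0).mul (measurable_coord 1))) i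

/-- **`E[F·Q] = n·m_B`** under `⊗ⁿγ`. [folklore] -/
theorem integral_FBv_mul_QBv :
    ∫ v, FBv v * QBv v ∂(Measure.pi fun _ : Fin n => stdGaussian V3) = n * mB := by
  have hexp : (fun v : Fin n → V3 => FBv v * QBv v) = fun v => ∑ i, ∑ j, ∑ k, term i j k v := by
    funext v
    unfold FBv QBv Pv term
    rw [Finset.sum_mul_sum, Finset.sum_mul]
    refine Finset.sum_congr rfl fun i _ => ?_
    rw [Finset.mul_sum]
    refine Finset.sum_congr rfl fun j _ => ?_
    rw [Finset.mul_sum]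
  rw [hexp, integral_finsetSum _ fun i _ =>
    integrable_finsetSum _ fun j _ => integrable_finsetSum _ fun k _ => integrable_term i j k]
  have hi : ∀ i : Fin n, ∫ v, ∑ j, ∑ k, term i j k v ∂(Measure.pi fun _ : Fin n => stdGaussian V3) = mB := by
    intro i
    rw [integral_finsetSum _ fun j _ => integrable_finsetSum _ fun k _ => integrable_term i j k]
    rw [Finset.sum_eq_single i ?_ (fun h => (h (Finset.mem_univ i)).elim)]
    · rw [integral_finsetSum _ fun k _ => integrable_term i i k]
      rw [Finset.sum_eq_single i (fun k _ hki => integral_term_of_ne_right hki)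
        (fun h => (h (Finset.mem_univ i)).elim)]
      exact integral_term_diag i
    · intro j _ hji
      rw [integral_finsetSum _ fun k _ => integrable_term i j k]
      exact Finset.sum_eq_zero fun k _ => integral_term_of_ne_left hji
  simp only [hi, Finset.sum_const, Finset.card_univ, Fintype.card_fin, nsmul_eq_mul]

/-- `F·Q` is integrable under `⊗ⁿγ`. [folklore] -/
theorem integrable_FBv_mul_QBv :
    Integrable (fun v : Fin n → V3 => FBv v * QBv v) (Measure.pi fun _ : Fin n => stdGaussian V3) :=
  integrable_QBv.bdd_mul measurable_FBv.aestronglyMeasurable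
    (Eventually.of_forall fun v => by rw [Real.norm_eq_abs]; exact abs_FBv_le v)

/-! ### The exact second moment `E[Q²] = n²` (independence of particles and of coordinates) -/

/-- Two DISTINCT particles are independent under `⊗ⁿγ`. [folklore] -/
theorem integral_pi_mul_of_ne {i k : Fin n} (hik : i ≠ k) {f g : V3 → ℝ} (hf : Measurable f) (hg : Measurable g) :
    ∫ v, f (v i) * g (v k) ∂(Measure.pi fun _ : Fin n => stdGaussian V3) =
      (∫ w, f w ∂stdGaussian V3) * ∫ w, g w ∂stdGaussian V3 := by
  have hind : iIndepFun (fun j (v : Fin n → V3) => v j) (Measure.pi fun _ : Fin n => stdGaussian V3) :=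
    iIndepFun_pi (X := fun _ => id) fun _ => aemeasurable_id
  have hpair : IndepFun (fun v : Fin n → V3 => f (v i)) (fun v => g (v k))
      (Measure.pi fun _ : Fin n => stdGaussian V3) :=
    (hind.indepFun hik).comp hf hg
  rw [hpair.integral_fun_mul_eq_mul_integral (hf.comp (measurable_pi_apply i)).aestronglyMeasurable
      (hg.comp (measurable_pi_apply k)).aestronglyMeasurable,
    integral_diag (stdGaussian V3) f hf i, integral_diag (stdGaussian V3) g hg k]

/-- One term `vᵢ₀ vⱼ₀ · vₖ₁ vₗ₁` of `Q²`. [folklore] -/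
def term4 (i j k l : Fin n) (v : Fin n → V3) : ℝ := v i 0 * v j 0 * (v k 1 * v l 1)

/-- `|abcd| ≤ a⁴ + b⁴ + c⁴ + d⁴`. [folklore] -/
theorem abs_mul_four_le (a b c d : ℝ) : |a * b * (c * d)| ≤ a ^ 4 + b ^ 4 + c ^ 4 + d ^ 4 := by
  have h1 : |a * b| ≤ (a ^ 2 + b ^ 2) / 2 := by
    rw [abs_le]; constructor <;> nlinarith [sq_nonneg (a + b), sq_nonneg (a - b)]
  have h2 : |c * d| ≤ (c ^ 2 + d ^ 2) / 2 := by
    rw [abs_le]; constructor <;> nlinarith [sq_nonneg (c + d), sq_nonneg (c - d)]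
  rw [abs_mul]
  have h3 : |a * b| * |c * d| ≤ (a ^ 2 + b ^ 2) / 2 * ((c ^ 2 + d ^ 2) / 2) :=
    mul_le_mul h1 h2 (abs_nonneg _) (by positivity)
  nlinarith [sq_nonneg (a ^ 2 + b ^ 2 - (c ^ 2 + d ^ 2)), sq_nonneg (a ^ 2 - b ^ 2), sq_nonneg (c ^ 2 - d ^ 2)]

/-- Each term of `Q²` is integrable. [folklore] -/
theorem integrable_term4 (i j k l : Fin n) :
    Integrable (term4 i j k l) (Measure.pi fun _ : Fin n => stdGaussian V3) := by
  have hdom : Integrable (fun v : Fin n → V3 => (v i 0) ^ 4 + (v j 0) ^ 4 + (v k 1) ^ 4 + (v l 1) ^ 4)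
      (Measure.pi fun _ : Fin n => stdGaussian V3) :=
    (((integrable_pi_coord_pow_four i 0).add (integrable_pi_coord_pow_four j 0)).add
      (integrable_pi_coord_pow_four k 1)).add (integrable_pi_coord_pow_four l 1)
  have hmeas : Measurable (term4 i j k l : (Fin n → V3) → ℝ) :=
    (((measurable_coord 0).comp (measurable_pi_apply i)).mul ((measurable_coord 0).comp (measurable_pi_apply j))).mul
      (((measurable_coord 1).comp (measurable_pi_apply k)).mul ((measurable_coord 1).comp (measurable_pi_apply l)))
  refine hdom.mono' hmeas.aestronglyMeasurable (Eventually.of_forall fun v => ?_)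
  rw [Real.norm_eq_abs]
  exact abs_mul_four_le _ _ _ _

/-- Terms with `i ≠ j` vanish: reflect coordinate `0` of particle `i`. [folklore] -/
theorem integral_term4_of_ne_left {i j k l : Fin n} (hij : i ≠ j) :
    ∫ v, term4 i j k l v ∂(Measure.pi fun _ : Fin n => stdGaussian V3) = 0 := by
  have h1 := (measurePreserving_flipWith (stdGaussian V3) (reflT 0) (measurePreserving_reflT 0) i).integral_comp
    (flipWith (reflT 0) i).measurableEmbedding (term4 i j k l)
  have hco : ∀ (m : Fin n) (v : Fin n → V3), flipWith (reflT 0) i v m 1 = v m 1 := by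
    intro m v
    rw [flipWith_apply]
    by_cases hmi : m = i
    · subst hmi; rw [if_pos rfl, reflT_apply, if_neg (by decide)]
    · rw [if_neg hmi]
  have h2 : (fun v : Fin n → V3 => term4 i j k l (flipWith (reflT 0) i v)) = fun v => -term4 i j k l v := by
    funext v
    unfold term4
    rw [hco k v, hco l v, flipWith_apply, flipWith_apply, if_pos rfl, if_neg hij.symm, reflT_apply, if_pos rfl]
    ring
  rw [h2, integral_neg] at h1
  linarith

/-- Terms with `i = j`, `k ≠ l` vanish: reflect coordinate `1` of particle `k`. [folklore] -/
theorem integral_term4_of_ne_right {i k l : Fin n} (hkl : k ≠ l) :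
    ∫ v, term4 i i k l v ∂(Measure.pi fun _ : Fin n => stdGaussian V3) = 0 := by
  have h1 := (measurePreserving_flipWith (stdGaussian V3) (reflT 1) (measurePreserving_reflT 1) k).integral_comp
    (flipWith (reflT 1) k).measurableEmbedding (term4 i i k l)
  have hco : ∀ (m : Fin n) (v : Fin n → V3), flipWith (reflT 1) k v m 0 = v m 0 := by
    intro m v
    rw [flipWith_apply]
    by_cases hmk : m = k
    · subst hmk; rw [if_pos rfl, reflT_apply, if_neg (by decide)]
    · rw [if_neg hmk]
  have h2 : (fun v : Fin n → V3 => term4 i i k l (flipWith (reflT 1) k v)) = fun v => -term4 i i k l v := by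
    funext v
    unfold term4
    rw [hco i v, flipWith_apply, flipWith_apply, if_pos rfl, if_neg hkl.symm, reflT_apply, if_pos rfl]
    ring
  rw [h2, integral_neg] at h1
  linarith

/-- Diagonal terms are `1`: `E[vᵢ₀² vₖ₁²] = E[w₀²]·E[w₁²] = 1` (one particle: independence of coordinates; two particles:
independence of particles). [folklore] -/
theorem integral_term4_diag (i k : Fin n) :
    ∫ v, term4 i i k k v ∂(Measure.pi fun _ : Fin n => stdGaussian V3) = 1 := by
  have hsq0 : ∫ w : V3, w 0 * w 0 ∂stdGaussian V3 = 1 := by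
    simp_rw [← sq]; exact integral_coord_sq_stdGaussian 0
  have hsq1 : ∫ w : V3, w 1 * w 1 ∂stdGaussian V3 = 1 := by
    simp_rw [← sq]; exact integral_coord_sq_stdGaussian 1
  have hm : Measurable fun x : ℝ => x * x := measurable_id.mul measurable_id
  by_cases hik : i = k
  · subst hik
    unfold term4
    rw [integral_diag (stdGaussian V3) (fun w => w 0 * w 0 * (w 1 * w 1))
      (((measurable_coord 0).mul (measurable_coord 0)).mul ((measurable_coord 1).mul (measurable_coord 1))) i]
    rw [integral_coord_mul_coord_of_ne (k := 0) (l := 1) (by decide) (f := fun x => x * x) (g := fun x => x * x) hm hm,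
      hsq0, hsq1, mul_one]
  · unfold term4
    rw [integral_pi_mul_of_ne hik (f := fun w => w 0 * w 0) (g := fun w => w 1 * w 1)
      ((measurable_coord 0).mul (measurable_coord 0)) ((measurable_coord 1).mul (measurable_coord 1)), hsq0, hsq1, mul_one]

/-- **`E[Q²] = n²` exactly** under `⊗ⁿγ`. [folklore] -/
theorem integral_QBv_sq_eq :
    ∫ v, QBv v ^ 2 ∂(Measure.pi fun _ : Fin n => stdGaussian V3) = (n : ℝ) ^ 2 := by
  have hexp : (fun v : Fin n → V3 => QBv v ^ 2) = fun v => ∑ i, ∑ j, ∑ k, ∑ l, term4 i j k l v := by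
    funext v
    unfold QBv Pv term4
    rw [sq, show (∑ i, v i 0) * (∑ i, v i 1) * ((∑ i, v i 0) * ∑ i, v i 1) =
      ((∑ i, v i 0) * ∑ j, v j 0) * ((∑ k, v k 1) * ∑ l, v l 1) by ring]
    rw [Finset.sum_mul_sum, Finset.sum_mul_sum, Finset.sum_mul]
    refine Finset.sum_congr rfl fun i _ => ?_
    rw [Finset.sum_mul]
    refine Finset.sum_congr rfl fun j _ => ?_
    rw [Finset.mul_sum]
    refine Finset.sum_congr rfl fun k _ => ?_
    rw [Finset.mul_sum]
  rw [hexp, integral_finsetSum _ fun i _ => integrable_finsetSum _ fun j _ =>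
    integrable_finsetSum _ fun k _ => integrable_finsetSum _ fun l _ => integrable_term4 i j k l]
  have hi : ∀ i : Fin n, ∫ v, ∑ j, ∑ k, ∑ l, term4 i j k l v ∂(Measure.pi fun _ : Fin n => stdGaussian V3) = n := by
    intro i
    rw [integral_finsetSum _ fun j _ => integrable_finsetSum _ fun k _ =>
      integrable_finsetSum _ fun l _ => integrable_term4 i j k l]
    rw [Finset.sum_eq_single i ?_ (fun h => (h (Finset.mem_univ i)).elim)]
    · rw [integral_finsetSum _ fun k _ => integrable_finsetSum _ fun l _ => integrable_term4 i i k l]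
      have hk : ∀ k : Fin n, ∫ v, ∑ l, term4 i i k l v ∂(Measure.pi fun _ : Fin n => stdGaussian V3) = 1 := by
        intro k
        rw [integral_finsetSum _ fun l _ => integrable_term4 i i k l]
        rw [Finset.sum_eq_single k (fun l _ hlk => integral_term4_of_ne_right (Ne.symm hlk))
          (fun h => (h (Finset.mem_univ k)).elim)]
        exact integral_term4_diag i k
      simp only [hk, Finset.sum_const, Finset.card_univ, Fintype.card_fin, nsmul_eq_mul, mul_one]
    · intro j _ hji
      rw [integral_finsetSum _ fun k _ => integrable_finsetSum _ fun l _ => integrable_term4 i j k l]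
      refine Finset.sum_eq_zero fun k _ => ?_
      rw [integral_finsetSum _ fun l _ => integrable_term4 i j k l]
      exact Finset.sum_eq_zero fun l _ => integral_term4_of_ne_left (Ne.symm hji)
  simp only [hi, Finset.sum_const, Finset.card_univ, Fintype.card_fin, nsmul_eq_mul]
  ring

end BoltzmannGreenKuboQuadraticMazur

end Summit.AtomisticToContinuum.HydrodynamicLimit.Theorems

end
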